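import Literature.NumberTheory.GaloisRepresentations.RamificationFiltration
import HarnessLib

/-!
# Lower ramification breaks through a uniformiser: `σθ ≡ θ (mod 𝔓ⁱ)` forces `σ ∈ G_{i-1}`

`Proofs` file (theorems only) in topic `NumberTheory/GaloisRepresentations`, next to the lower
ramification groups `Ideal.ramificationSubgroup` of `RamificationFiltration` (item C9), landed by
the seat of bsd.S15 (`Literature.NumberTheory.EllipticCurves.conductorNorm_eq_artinConductorNat`)
as a tool for the one computation left in Silverman's proof of Ogg's formula at `p = 3`
(*ATAEC* IV.11.1, PDF pp. 369–370): the break `r` of the cyclic cubic layer `L/M` of the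
`2`-division field is read off a uniformiser, *"the definition of the higher ramification groups
says that `r = v_L(π_L^σ - π_L)`"* — i.e. Serre, *Local Fields*, IV §1, Lemma 1 with Prop. 5:
for a totally ramified layer generated by a uniformiser `π_L`, `i_G(σ) = v_L(σπ_L - π_L)`.

We isolate the ring-theoretic mechanism, valid for any commutative ring `S`, ideal `𝔓`, ring
endomorphism `σ` with `σ(𝔓) ⊆ 𝔓`, under the two hypotheses expressing "totally ramified layer
generated by `θ`":

* (residue degree one over the fixed ring) every `x ∈ S` is congruent modulo `𝔓` to an element
  fixed by `σ`;
* (`θ` is a uniformiser) `θ ∈ 𝔓` and `𝔓 ⊆ (θ) + 𝔓ⁿ` for every `n ≥ 2`.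

Then `σθ - θ ∈ 𝔓ⁱ` implies `σx - x ∈ 𝔓ⁱ` for **every** `x ∈ S`
(`sub_mem_pow_of_sub_uniformizer_mem_pow`): expand `x ≡ Σ_{k<n} c_k θ^k (mod 𝔓ⁿ)` with fixed
coefficients, and note that `σ(c θ^k) - c θ^k` is a multiple of `σθ - θ` modulo the induction.
Consequently an element of the decomposition group with `σ • θ - θ ∈ 𝔓ⁱ` lies in the lower
ramification group `G_{i-1}` (`mem_ramificationSubgroup_of_smul_uniformizer_sub_mem_pow`), so that
`min_x v_𝔓(σx - x) = v_𝔓(σθ - θ)`.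

## References

* [SerreLocalFields1979] J.-P. Serre, *Local Fields*, GTM 67, Ch. IV §1, Lemma 1 and Prop. 5
  (`i_G(s) = v_L(s(x) - x)` for a generator `x` of `A_L` over `A_K`; Ch. I §6 Prop. 18: a
  uniformiser generates in the totally ramified case).
* [SilvermanATAEC1994] J. H. Silverman, *Advanced Topics*, proof of Thm. IV.11.1 for `p = 3`,
  PDF p. 370 ("`r = v_L(π_L^σ - π_L)`").

## Design

Pure theorems; no Dedekind hypothesis (the uniformiser property is taken as the hypothesis
`𝔓 ≤ span {θ} ⊔ 𝔓 ^ (n + 2)`, which in a Dedekind domain holds for any `θ ∈ 𝔓 \ 𝔓²`).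
Axioms: `propext`, `Classical.choice`, `Quot.sound`.
-/

open scoped Pointwise

namespace Literature.NumberTheory.GaloisRepresentations

variable {S : Type*} [CommRing S]

/-- A ring endomorphism mapping `𝔓` into itself maps `𝔓ⁿ` into itself. [folklore] -/
theorem map_mem_pow_of_forall_map_mem (𝔓 : Ideal S) (σ : S →+* S) (hσ : ∀ x ∈ 𝔓, σ x ∈ 𝔓) :
    ∀ (n : ℕ) {x : S}, x ∈ 𝔓 ^ n → σ x ∈ 𝔓 ^ n := by
  intro n
  induction n with
  | zero => intro x _; simp
  | succ n ih =>
    intro x hx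
    rw [pow_succ] at hx ⊢
    refine Submodule.mul_induction_on hx (fun a ha b hb ↦ ?_) (fun a b ha hb ↦ ?_)
    · rw [map_mul]; exact Ideal.mul_mem_mul (ih ha) (hσ b hb)
    · rw [map_add]; exact Ideal.add_mem _ ha hb

/-- **`σθ ≡ θ (mod 𝔓ⁱ)` for a uniformiser `θ` of a totally ramified layer forces
`σx ≡ x (mod 𝔓ⁱ)` for all `x`** (Serre, *Local Fields*, IV §1, Lemma 1 with Prop. 5, ring
form).  Hypotheses: `σ(𝔓) ⊆ 𝔓`; every element is congruent mod `𝔓` to a `σ`-fixed element;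
`θ ∈ 𝔓` and `𝔓 ⊆ (θ) + 𝔓^{n+2}` for all `n`.  Proof: by induction on `n`,
`σx - x ∈ 𝔓ⁱ + 𝔓ⁿ` for every `x`: write `x = c + θx₁ + p` with `σc = c`, `p ∈ 𝔓^{max i (n+1)}`,
so `σx - x = (σθ - θ)σx₁ + θ(σx₁ - x₁) + (σp - p)`.
[cite: SerreLocalFields1979, Ch. IV §1 Lemma 1 and Prop. 5] -/
theorem sub_mem_pow_of_sub_uniformizer_mem_pow (𝔓 : Ideal S) (σ : S →+* S)
    (hσ : ∀ x ∈ 𝔓, σ x ∈ 𝔓) (hfix : ∀ x : S, ∃ c : S, σ c = c ∧ x - c ∈ 𝔓)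
    {θ : S} (hθ𝔓 : θ ∈ 𝔓) (hθ : ∀ n : ℕ, 𝔓 ≤ Ideal.span {θ} ⊔ 𝔓 ^ (n + 2))
    {i : ℕ} (hi : σ θ - θ ∈ 𝔓 ^ i) (x : S) : σ x - x ∈ 𝔓 ^ i := by
  -- `σx - x ∈ 𝔓ⁱ ⊔ 𝔓ⁿ` for every `n`, by induction on `n`
  suffices key : ∀ (n : ℕ) (x : S), σ x - x ∈ 𝔓 ^ i ⊔ 𝔓 ^ n by
    have := key i x
    rwa [sup_idem] at this
  intro n
  induction n with
  | zero => intro x; simp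
  | succ n ih =>
    intro x
    obtain ⟨c, hc, hxc⟩ := hfix x
    -- `x - c = θ x₁ + p`, `p ∈ 𝔓 ^ (max i (n + 1))`
    set e : ℕ := max i (n + 1) with he
    have hle : 𝔓 ≤ Ideal.span {θ} ⊔ 𝔓 ^ e := by
      refine le_trans (hθ e) (sup_le_sup_left (Ideal.pow_le_pow_right (by omega)) _)
    obtain ⟨y, hy, p, hp, hsum⟩ := Submodule.mem_sup.mp (hle hxc)
    obtain ⟨x₁, rfl⟩ := Ideal.mem_span_singleton'.mp hy
    have hx : x = c + x₁ * θ + p := by linear_combination -hsum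
    have hdecomp : σ x - x = (σ θ - θ) * σ x₁ + θ * (σ x₁ - x₁) + (σ p - p) := by
      rw [hx, map_add, map_add, map_mul, hc]; ring
    rw [hdecomp]
    refine Ideal.add_mem _ (Ideal.add_mem _ ?_ ?_) ?_
    · exact Ideal.mem_sup_left (Ideal.mul_mem_right _ _ hi)
    · -- `θ (σx₁ - x₁) ∈ 𝔓 (𝔓ⁱ ⊔ 𝔓ⁿ) ⊆ 𝔓ⁱ ⊔ 𝔓ⁿ⁺¹`
      have h1 := ih x₁
      obtain ⟨a, ha, b, hb, hab⟩ := Submodule.mem_sup.mp h1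
      rw [← hab, mul_add, mul_comm θ b]
      refine Ideal.add_mem _ (Ideal.mem_sup_left (Ideal.mul_mem_left _ _ ha))
        (Ideal.mem_sup_right ?_)
      rw [pow_succ]
      exact Ideal.mul_mem_mul hb hθ𝔓
    · -- `σp - p ∈ 𝔓ᵉ ⊆ 𝔓ⁿ⁺¹`
      have hσp : σ p ∈ 𝔓 ^ e := map_mem_pow_of_forall_map_mem 𝔓 σ hσ e hp
      have : σ p - p ∈ 𝔓 ^ e := Ideal.sub_mem _ hσp hp
      exact Ideal.mem_sup_right (Ideal.pow_le_pow_right (by omega) this)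

/-- **Membership in a lower ramification group read off a uniformiser** (Serre, *Local Fields*,
IV §1, Prop. 5: `i_G(s) = v_L(s π_L - π_L)` in the totally ramified monogenic case).  For a
group `G` acting on `S` by ring automorphisms, an ideal `𝔓`, and `σ ∈ G` stabilising `𝔓` such
that every element of `S` is congruent mod `𝔓` to a `σ`-fixed element, and a uniformiser `θ`
(`θ ∈ 𝔓`, `𝔓 ⊆ (θ) + 𝔓^{n+2}` for all `n`): if `σ • θ - θ ∈ 𝔓^{i+1}` then `σ ∈ G_i`.
[cite: SerreLocalFields1979, Ch. IV §1 Lemma 1 and Prop. 5] -/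
theorem mem_ramificationSubgroup_of_smul_uniformizer_sub_mem_pow {G : Type*} [Group G]
    [MulSemiringAction G S] (𝔓 : Ideal S) {σ : G} (hσ𝔓 : σ • 𝔓 = 𝔓)
    (hfix : ∀ x : S, ∃ c : S, σ • c = c ∧ x - c ∈ 𝔓)
    {θ : S} (hθ𝔓 : θ ∈ 𝔓) (hθ : ∀ n : ℕ, 𝔓 ≤ Ideal.span {θ} ⊔ 𝔓 ^ (n + 2))
    {i : ℕ} (hi : σ • θ - θ ∈ 𝔓 ^ (i + 1)) : σ ∈ 𝔓.ramificationSubgroup G i := by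
  rw [Ideal.mem_ramificationSubgroup_iff]
  refine ⟨hσ𝔓, fun x ↦ ?_⟩
  have hσ : ∀ x ∈ 𝔓, MulSemiringAction.toRingHom G S σ x ∈ 𝔓 := by
    intro x hx
    rw [MulSemiringAction.toRingHom_apply, ← hσ𝔓]
    exact Ideal.smul_mem_pointwise_smul_iff.mpr hx
  exact sub_mem_pow_of_sub_uniformizer_mem_pow 𝔓 (MulSemiringAction.toRingHom G S σ) hσ
    (fun x ↦ by obtain ⟨c, hc, hxc⟩ := hfix x; exact ⟨c, hc, hxc⟩) hθ𝔓 hθ hi x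

end Literature.NumberTheory.GaloisRepresentations
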